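import Summits.CriticalPhenomena.SAWScalingLimit.Theorems.SAWTotalPositivityBoundaryTP2Supercritical
import HarnessLib

/-!
# The three-point splitting inequality fails at every supercritical fugacity
# (crux `LeftRightFKG`, stmt-CriticalPhenomena-11232, line `corner-localisation`, skeleton v7, stub `stub_threePoint`)

Lead c2 (prover-line-stmt-CriticalPhenomena-11232-c2-0, 2026-08-16). Skeleton v7 reduces the crux to the sibling
core `BoundaryTP2.GraphTP2At x_c` and the THREE-POINT SPLITTING INEQUALITY at `x_c` (`ThreePointAt x_c`,
vocabulary file `…ThreePointDefs`; written out below so that this file depends on landed modules only):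
`Z_H(w,p) · Z_H(w,q) ≤ Z_H(p,q)` for every finite `H ≤ ℤ²`, every vertex `w` with a lattice neighbour isolated
in `H` and all `p, q` with `w, p, q` pairwise distinct (`Z_H = BoundaryTP2.pathKernel H x`). This file shows that
the new stub, like the core, is `x_c`-SHARP:

* `pathKernel_le_one_of_threePoint` — the three-point inequality at `x > 0` forces `Z_B(w,w') ≤ 1` for any two
  vertices `w ≠ w'` of a finite `B ≤ ℤ²` that both have an isolated lattice neighbour, as soon as a third vertex
  `q` has `Z_B(w,q) ≠ 0` (apply the inequality at `w` to `(w', q)` and at `w'` to `(w, q)` and multiply: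
  `Z(w,w')² · Z(w,q) ≤ Z(w,q)`);
* `not_threePoint_of_criticalFugacity_lt` — **for `x_c < x < 1` the three-point inequality is false**: with
  `B` the graph of all lattice edges of the square `[0,2m+1]²`, `w w'` its bottom cardinal edge (both ends have
  their outer neighbours isolated) and `q = (m,1)`, the bound `Z_B(w,w') ≤ 1` contradicts Duminil-Copin–Kozma–Yadin's
  Proposition 3 (`SAW.DKY2014_prop3_holds`, PROVED in the tree) exactly as in the sibling's
  `BoundaryTP2.not_graphTP2At_of_criticalFugacity_lt`, whose polygon-opening argument
  (`BoundaryTP2.exists_path_of_isCycle_of_mem_edges`) is reused verbatim: every polygon of the square through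
  `w w'` is that edge plus a self-avoiding path `w → w'` of `B`, injectively, so `Z_m(x) ≤ x · Z_B(w,w') ≤ x < 1`
  for all `m`, while `limsup_m Z_m(x) = ∞`;
* `le_criticalFugacity_of_threePoint` — hence a fugacity `x < 1` at which the three-point inequality holds is
  `≤ x_c`: the stub asserts it at the largest possible fugacity, and no proof of it can avoid an input that is
  false above `x_c`.

Everything here is proved (adapted from `…BoundaryTP2Supercritical`, lead c4 of the sibling crux). [folklore]
-/

noncomputable section

namespace Summit.CriticalPhenomena.SAWScalingLimit.Theorems.LeftRightFKG.ThreePoint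

open Literature.Probability.LatticeModels Literature.Probability.RandomPlanarGeometry
open Summit.CriticalPhenomena.SAWScalingLimit.Theorems.BoundaryTP2
open scoped ENNReal

variable {V : Type*}

/-! ## Non-vanishing of the kernel -/

/-- For `x > 0` the kernel between mutually reachable vertices is non-zero (a walk bypasses to a path, whose
term `x^{|γ|} > 0`). [folklore] -/
theorem pathKernel_ne_zero_of_reachable [DecidableEq V] (H : SimpleGraph V) {x : ℝ} (hx : 0 < x) {a b : V}
    (h : H.Reachable a b) : pathKernel H x a b ≠ 0 := by
  obtain ⟨p⟩ := h
  intro h0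
  rw [pathKernel, ENNReal.tsum_eq_zero] at h0
  have := h0 p.toPath
  rw [ENNReal.ofReal_eq_zero] at this
  exact absurd this (not_le.2 (pow_pos hx _))

/-! ## The two-point bound forced by the three-point inequality -/

/-- **`Z_B(w,w') ≤ 1` from the three-point inequality.** If the three-point splitting inequality holds at
`x` (written out), then for a finite `B ≤ ℤ²`, two distinct vertices `w`, `w'` each having a lattice neighbour
isolated in `B`, and a third vertex `q` with `Z_B(w,q) ≠ 0`: `Z_B(w,w') ≤ 1`. Proof: the inequality at `w`
for `(w',q)` and at `w'` for `(w,q)` give `Z(w,w')Z(w,q) ≤ Z(w',q)` and `Z(w',w)Z(w',q) ≤ Z(w,q)`, whence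
`Z(w,w')²·Z(w,q) ≤ Z(w,q)` with `0 < Z(w,q) < ∞`. [folklore] -/
theorem pathKernel_le_one_of_threePoint {x : ℝ}
    (h₃ : ∀ H : SimpleGraph (Site 2), H ≤ zdGraph 2 → H.support.Finite →
      ∀ w w' p q : Site 2, (zdGraph 2).Adj w w' → w' ∉ H.support → w ≠ p → w ≠ q → p ≠ q →
        pathKernel H x w p * pathKernel H x w q ≤ pathKernel H x p q)
    (B : SimpleGraph (Site 2)) (hB : B ≤ zdGraph 2) (hfin : B.support.Finite) {w w' u u' q : Site 2}
    (hwu : (zdGraph 2).Adj w u) (hw'u' : (zdGraph 2).Adj w' u') (hu : u ∉ B.support) (hu' : u' ∉ B.support)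
    (hww' : w ≠ w') (hwq : w ≠ q) (hw'q : w' ≠ q) (hq : pathKernel B x w q ≠ 0) :
    pathKernel B x w w' ≤ 1 := by
  have h1 : pathKernel B x w w' * pathKernel B x w q ≤ pathKernel B x w' q :=
    h₃ B hB hfin w u w' q hwu hu hww' hwq hw'q
  have h2 : pathKernel B x w w' * pathKernel B x w' q ≤ pathKernel B x w q := by
    rw [pathKernel_comm B x w w']
    exact h₃ B hB hfin w' u' w q hw'u' hu' hww'.symm hw'q hwq
  set a := pathKernel B x w w'
  set b := pathKernel B x w q
  have hb : b ≠ ∞ := pathKernel_ne_top hfin x w q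
  have hsq : a * a * b ≤ 1 * b := by
    calc a * a * b = a * (a * b) := by ring
      _ ≤ a * pathKernel B x w' q := mul_le_mul_right h1 a
      _ ≤ b := h2
      _ = 1 * b := (one_mul b).symm
  have haa : a * a ≤ 1 := (ENNReal.mul_le_mul_iff_left hq hb).1 hsq
  by_contra ha
  have ha' : 1 < a := not_le.1 ha
  have : (1 : ℝ≥0∞) < a * a :=
    calc (1 : ℝ≥0∞) < a := ha'
      _ = a * 1 := (mul_one a).symm
      _ ≤ a * a := mul_le_mul_right ha'.le a
  exact absurd (this.trans_le haa) (lt_irrefl 1)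

/-! ## The box graph of `[0, 2m+1]²`, its bottom cardinal edge and the point above it -/

section Box

/-- `ℤ²`-adjacency from `b = a + eᵢ`. [folklore] -/
theorem zd_adj_of_eq_add_single' {a b : Site 2} (i : Fin 2) (h : b = a + Pi.single i 1) :
    (zdGraph 2).Adj a b :=
  (zdGraph_adj_iff a b).2 ⟨i, Or.inl h⟩

/-- `(m,0) ∼ (m+1,0)` in `ℤ²`. [folklore] -/
theorem adj_bw_bw' (m : ℕ) : (zdGraph 2).Adj (![(m : ℤ), 0]) (![(m : ℤ) + 1, 0]) :=
  zd_adj_of_eq_add_single' 0 (by ext i; fin_cases i <;> simp)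

/-- `(m,0) ∼ (m,-1)` in `ℤ²`. [folklore] -/
theorem adj_bw_bu (m : ℕ) : (zdGraph 2).Adj (![(m : ℤ), 0]) (![(m : ℤ), -1]) :=
  (zd_adj_of_eq_add_single' 1 (by ext i; fin_cases i <;> simp)).symm

/-- `(m+1,0) ∼ (m+1,-1)` in `ℤ²`. [folklore] -/
theorem adj_bw'_bu' (m : ℕ) : (zdGraph 2).Adj (![(m : ℤ) + 1, 0]) (![(m : ℤ) + 1, -1]) :=
  (zd_adj_of_eq_add_single' 1 (by ext i; fin_cases i <;> simp)).symm

/-- `(m,0) ∼ (m,1)` in `ℤ²`. [folklore] -/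
theorem adj_bw_bq (m : ℕ) : (zdGraph 2).Adj (![(m : ℤ), 0]) (![(m : ℤ), 1]) :=
  zd_adj_of_eq_add_single' 1 (by ext i; fin_cases i <;> simp)

/-- Membership of an explicit point in the square `[0,2m+1]²`. [folklore] -/
theorem vec2_mem_squareBox {m : ℕ} {a b : ℤ} (ha : 0 ≤ a) (ha' : a ≤ 2 * m + 1) (hb : 0 ≤ b)
    (hb' : b ≤ 2 * m + 1) : ![a, b] ∈ SAW.squareBox m := by
  rw [SAW.mem_squareBox_iff]; intro i; fin_cases i
  · exact ⟨by simpa using ha, by simpa using ha'⟩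
  · exact ⟨by simpa using hb, by simpa using hb'⟩

end Box

/-- **The three-point inequality fails above `x_c`.** For every fugacity `x` with `x_c < x < 1` the
three-point splitting inequality (written out; `= ThreePointAt x`) is false. See the module docstring:
`Z_B(w,w') ≤ 1` at the bottom cardinal edge of the box `[0,2m+1]²` (from the inequality at `w` and at `w'`
with the third point `q = (m,1)`), polygons of the box through that edge open up into paths `w → w'`, so
`Z_m(x) ≤ x < 1` for all `m`, contradicting DKY's Proposition 3. [cite: DuminilCopinKozmaYadin2014, Proposition 3] -/
theorem not_threePoint_of_criticalFugacity_lt {x : ℝ} (hxc : SAW.criticalFugacity < x) (hx1 : x < 1) :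
    ¬ (∀ H : SimpleGraph (Site 2), H ≤ zdGraph 2 → H.support.Finite →
      ∀ w w' p q : Site 2, (zdGraph 2).Adj w w' → w' ∉ H.support → w ≠ p → w ≠ q → p ≠ q →
        pathKernel H x w p * pathKernel H x w q ≤ pathKernel H x p q) := by
  classical
  intro h
  have hx0 : 0 < x := lt_trans SAW.criticalFugacity_pos hxc
  -- for every `m`, `Z_m(x) ≤ x`
  have hbox : ∀ m : ℕ, SAW.Zbox m x ≤ x := by
    intro m
    -- the box graph
    set Λ := SAW.squareBox m with hΛ
    set S : Set (Sym2 (Site 2)) := ↑(edgesIn (zdGraph 2) Λ) with hS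
    set B := SimpleGraph.fromEdgeSet S with hB
    have hBadj : ∀ a b, B.Adj a b ↔ s(a, b) ∈ edgesIn (zdGraph 2) Λ ∧ a ≠ b := fun a b => by
      rw [hB, SimpleGraph.fromEdgeSet_adj, hS, Finset.mem_coe]
    have hBle : B ≤ zdGraph 2 := by
      intro a b hab
      rw [hBadj] at hab
      exact (SimpleGraph.mem_edgeSet (zdGraph 2)).1 ((mem_edgesIn_iff).1 hab.1).1
    have hsupp : ∀ a, a ∈ B.support → a ∈ Λ := by
      intro a ha
      obtain ⟨b, hab⟩ := (B.mem_support).1 ha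
      rw [hBadj] at hab
      exact ((mem_edgesIn_iff).1 hab.1).2 a (Sym2.mem_mk_left _ _)
    have hBfin : B.support.Finite := (Λ.finite_toSet).subset fun a ha => hsupp a ha
    -- the bottom cardinal edge, the outer points below it and the point above `w`
    set w : Site 2 := ![(m : ℤ), 0] with hw
    set w' : Site 2 := ![(m : ℤ) + 1, 0] with hw'
    set u : Site 2 := ![(m : ℤ), -1] with hu
    set u' : Site 2 := ![(m : ℤ) + 1, -1] with hu'
    set q : Site 2 := ![(m : ℤ), 1] with hq
    have hwΛ : w ∈ Λ := by
      rw [hw, hΛ]; exact vec2_mem_squareBox (by omega) (by omega) (by omega) (by omega)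
    have hw'Λ : w' ∈ Λ := by
      rw [hw', hΛ]; exact vec2_mem_squareBox (by omega) (by omega) (by omega) (by omega)
    have hqΛ : q ∈ Λ := by
      rw [hq, hΛ]; exact vec2_mem_squareBox (by omega) (by omega) (by omega) (by omega)
    have huΛ : u ∉ Λ := by
      rw [hΛ, SAW.mem_squareBox_iff]; intro hh; have := (hh 1).1; simp [hu] at this
    have hu'Λ : u' ∉ Λ := by
      rw [hΛ, SAW.mem_squareBox_iff]; intro hh; have := (hh 1).1; simp [hu'] at this
    have hmemE : ∀ {a b : Site 2}, (zdGraph 2).Adj a b → a ∈ Λ → b ∈ Λ → s(a, b) ∈ edgesIn (zdGraph 2) Λ := by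
      intro a b hab ha hb
      rw [mem_edgesIn_iff]
      refine ⟨(SimpleGraph.mem_edgeSet _).2 hab, fun c hc => ?_⟩
      rcases Sym2.mem_iff.1 hc with rfl | rfl
      exacts [ha, hb]
    have he₀ : s(w, w') ∈ edgesIn (zdGraph 2) Λ := hmemE (adj_bw_bw' m) hwΛ hw'Λ
    have hww' : B.Adj w w' := (hBadj w w').2 ⟨he₀, (adj_bw_bw' m).ne⟩
    have hwq : B.Adj w q := (hBadj w q).2 ⟨hmemE (adj_bw_bq m) hwΛ hqΛ, (adj_bw_bq m).ne⟩
    have huB : u ∉ B.support := fun hh => huΛ (hsupp u hh)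
    have hu'B : u' ∉ B.support := fun hh => hu'Λ (hsupp u' hh)
    have hw'q : w' ≠ q := by
      intro hh; have := congrFun hh 1; simp [hw', hq] at this
    -- the three-point bound `Z_B(w,w') ≤ 1`
    have hZ : pathKernel B x w w' ≤ 1 :=
      pathKernel_le_one_of_threePoint h B hBle hBfin (adj_bw_bu m) (adj_bw'_bu' m) huB hu'B hww'.ne hwq.ne hw'q
        (pathKernel_ne_zero_of_reachable B hx0 hwq.reachable)
    -- polygons of the box through `w w'` ↦ paths `w → w'` of `B` (verbatim from the sibling's proof)
    have hpoly : ∀ E ∈ SAW.facePolygons m, ∃ p : B.Path w w',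
        p.1.length + 1 = E.card ∧ insert s(w, w') p.1.edges.toFinset = E := by
      intro E hE
      obtain ⟨hEsub, ⟨v, c, hc, hcE⟩, hcard⟩ := SAW.mem_facePolygons_iff.1 hE
      have he₀E : s(w, w') ∈ E := hcard (by simp [SAW.cardinalEdges, hw, hw'])
      have he₀c : s(w, w') ∈ c.edges := by rw [← List.mem_toFinset, hcE]; exact he₀E
      obtain ⟨p, hpe, hpE⟩ := exists_path_of_isCycle_of_mem_edges c hc he₀c
      rw [hcE] at hpE
      have hpB : ∀ e ∈ p.1.edges, e ∈ B.edgeSet := by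
        intro e he
        have heE : e ∈ E := by rw [← hpE]; exact Finset.mem_insert_of_mem (List.mem_toFinset.2 he)
        rw [hB, SimpleGraph.edgeSet_fromEdgeSet, hS]
        exact ⟨Finset.mem_coe.2 (hEsub heE), (zdGraph 2).not_isDiag_of_mem_edgeSet (p.1.edges_subset_edgeSet he)⟩
      refine ⟨⟨p.1.transfer B hpB, p.2.transfer hpB⟩, ?_, ?_⟩
      · rw [SimpleGraph.Walk.length_transfer, ← hpE, ← SimpleGraph.Walk.length_edges]
        rw [Finset.card_insert_of_notMem (fun hh => hpe (List.mem_toFinset.1 hh)),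
          List.toFinset_card_of_nodup p.2.isTrail.edges_nodup]
      · rw [SimpleGraph.Walk.edges_transfer]; exact hpE
    haveI : Nonempty (B.Path w w') := ⟨SimpleGraph.Path.singleton hww'⟩
    choose! Φ hΦlen hΦE using hpoly
    set P := SAW.facePolygons m with hP
    have hinj : Function.Injective fun E : P => Φ E.1 := by
      intro E₁ E₂ heq
      apply Subtype.ext
      rw [← hΦE E₁.1 E₁.2, ← hΦE E₂.1 E₂.2]
      exact congrArg (fun γ : B.Path w w' => insert s(w, w') γ.1.edges.toFinset) heq
    have hsum : (∑ E ∈ P, ENNReal.ofReal (x ^ (E.card - 1))) ≤ pathKernel B x w w' := by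
      calc (∑ E ∈ P, ENNReal.ofReal (x ^ (E.card - 1)))
          = ∑ E ∈ P, ENNReal.ofReal (x ^ (Φ E).1.length) := by
            refine Finset.sum_congr rfl fun E hE => ?_
            rw [← hΦlen E hE, Nat.add_sub_cancel]
        _ = ∑ E : P, ENNReal.ofReal (x ^ (Φ E.1).1.length) := (Finset.sum_coe_sort P _).symm
        _ = ∑' E : P, ENNReal.ofReal (x ^ (Φ E.1).1.length) := (tsum_fintype _).symm
        _ ≤ ∑' γ : B.Path w w', ENNReal.ofReal (x ^ γ.1.length) :=
            ENNReal.tsum_comp_le_tsum_of_injective hinj fun γ : B.Path w w' => ENNReal.ofReal (x ^ γ.1.length)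
        _ = pathKernel B x w w' := rfl
    have hT : (∑ E ∈ P, x ^ (E.card - 1)) ≤ 1 := by
      have h1 : (∑ E ∈ P, ENNReal.ofReal (x ^ (E.card - 1))) ≤ 1 := hsum.trans hZ
      rw [← ENNReal.ofReal_sum_of_nonneg fun E _ => pow_nonneg hx0.le _] at h1
      exact ENNReal.ofReal_le_one.1 h1
    have hcard : ∀ E ∈ P, 1 ≤ E.card := fun E hE => by
      rw [← hΦlen E hE]; exact Nat.le_add_left 1 _
    calc SAW.Zbox m x = ∑ E ∈ P, x * x ^ (E.card - 1) := by
          rw [SAW.Zbox]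
          refine Finset.sum_congr rfl fun E hE => ?_
          rw [← pow_succ', Nat.sub_add_cancel (hcard E hE)]
      _ = x * ∑ E ∈ P, x ^ (E.card - 1) := by rw [Finset.mul_sum]
      _ ≤ x * 1 := mul_le_mul_of_nonneg_left hT hx0.le
      _ = x := mul_one x
  -- DKY Proposition 3: `Z_m(x) ≥ 1` for infinitely many `m`
  obtain ⟨m, hm⟩ := (SAW.DKY2014_prop3_holds x hxc 1).exists
  exact absurd ((hm.trans (hbox m)).trans_lt hx1) (lt_irrefl 1)

/-- **`x_c` is the edge of the three-point inequality.** If the three-point splitting inequality (written out;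
`= ThreePointAt x`) holds at some `x < 1`, then `x ≤ x_c`; the line's stub `stub_threePoint` asserts it at the
largest fugacity at which it can hold. [cite: DuminilCopinKozmaYadin2014, Proposition 3] -/
theorem le_criticalFugacity_of_threePoint {x : ℝ} (hx1 : x < 1)
    (h : ∀ H : SimpleGraph (Site 2), H ≤ zdGraph 2 → H.support.Finite →
      ∀ w w' p q : Site 2, (zdGraph 2).Adj w w' → w' ∉ H.support → w ≠ p → w ≠ q → p ≠ q →
        pathKernel H x w p * pathKernel H x w q ≤ pathKernel H x p q) :
    x ≤ SAW.criticalFugacity :=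
  le_of_not_gt fun hxc => not_threePoint_of_criticalFugacity_lt hxc hx1 h

/-- REGISTERED STUB `stub_threePointSupercritical` of line `corner-localisation` (lead c2): the three-point splitting
inequality (`= ThreePointAt x`, written out) fails at every `x_c < x < 1` — the line's open stub `stub_threePoint`
is `x_c`-sharp. [cite: DuminilCopinKozmaYadin2014, Proposition 3] -/
theorem stub_threePointSupercritical : ∀ x : ℝ, SAW.criticalFugacity < x → x < 1 →
    ¬ (∀ H : SimpleGraph (Site 2), H ≤ zdGraph 2 → H.support.Finite →
      ∀ w w' p q : Site 2, (zdGraph 2).Adj w w' → w' ∉ H.support → w ≠ p → w ≠ q → p ≠ q →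
        BoundaryTP2.pathKernel H x w p * BoundaryTP2.pathKernel H x w q ≤ BoundaryTP2.pathKernel H x p q) :=
  fun _ hxc hx1 => not_threePoint_of_criticalFugacity_lt hxc hx1

end Summit.CriticalPhenomena.SAWScalingLimit.Theorems.LeftRightFKG.ThreePoint

end
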